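import Summits.QuantumFields.YangMills.Theorems.BalabanUVNodesN22AtU3OfKernels

/-!
# (D4)'s ONE PRINTED CLAUSE AT THE KERNEL OBJECTS OF RECORD — `U3OfKernels.KernelDecay ∕ KernelDecayOfRecord₁₃` — FROM WINDOWED (5.10) DECAY AND THE
# EXISTENCE OF THE (1.21) LIMITS: the same estimate-free passage as `…N22AtU3OfKernels` §1, for the decay slot

Cell `pub-ymgap`, Track A (HUMAN RULING D-0062), WIDTH SEAT `dag-n22-w3` g2; `--kind proof --supports stmt-QuantumFields-20544 --as helper`, COUNT-NEUTRAL.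
Plan g81 Q1 RULING (β) (pub-ymgap INBOX l.26065): at the node-U3 object of record `Node00.U3OfKernels.objectsOfRecord₁₃` the (D4) conjunct is REDUCED (dag-n27-w1
`readOutAt_objectsOfRecord₁₃[_coPH]`, p591653) to ONE printed clause `KernelDecayOfRecord₁₃ F N θ 0 1 ℓ.κ` = [I] (5.10) p. 293 decay of the LIMITING kernels at a
`k`-uniform rate.  [I] proves (5.10) at finite volume («uniform in the lattice spacing», p. 259) and passes to the limit (1.21) p. 264 («This limit exists by the
localized representation (1.7)»).  This file types that passage for the decay slot, estimate-free: windowed (5.10) bounds `|Π^{(K)}_{k+1,μν}(g; z)| ≤ C₀(g) e^{−κ|z|₁}`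
holding EVENTUALLY IN `K` with ONE constant per coupling sequence (uniform in the level `k`), plus def-B's `PolLimitExists` at every history of the window, give
W1-19's `KernelDecay F ℰ ρ bV W μ ν κ` (§1) and, at the merged term family of record, `KernelDecayOfRecord₁₃ F N θ μ ν κ` (§2) — the `hdec` of dag-n27-w1's (D4) producer.
Tool: `abs_le_of_tendsto_of_eventually_le` (`le_of_tendsto` on `|·|` of a convergent sequence).

HONEST FRAMING (binding).  Bookkeeping + one `Filter.Tendsto` passage; THEOREMS ONLY (0 def, 0 sorry, standard axioms).  The windowed (5.10) bounds uniform in `K`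
and `k` and the existence of the (1.21) limits STAY DISPLAYED HYPOTHESES; nothing of Bałaban's is asserted; (D4) ∕ N17 NOT discharged; K3⁷ OPEN, not claimed; no count
claim; R4 closes the conditional finite-𝕋⁴ rung `BalabanLadder.UV` only; NOTHING about the continuum limit, ℝ⁴, OS axioms, a mass gap or Clay is proved or claimed.
-/

noncomputable section

open Filter Topology
open scoped BigOperators

namespace YMDAG.N22.AtKernels

open Literature.MathematicalPhysics.QuantumFieldTheory.Balaban1983to89
open Literature.MathematicalPhysics.QuantumFieldTheory.Balaban1983to89.T4Continuum (T4Family)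
open Literature.MathematicalPhysics.QuantumFieldTheory.Balaban1983to89.T4OutputRate (Window)
open Literature.MathematicalPhysics.QuantumFieldTheory.Balaban1983to89.Node00 (TermFamily1 polWindow polLimit PolLimitExists tendsto_polLimit mergedTermFamilyMatT
  TβOfRecord₁₃ chiβOfRecord₁₃ Stage13Params)
open Literature.MathematicalPhysics.QuantumFieldTheory.Balaban1983to89.Node00.U3OfKernels (histPrefix kernelA kernelA_eq KernelDecay KernelDecayOfRecord₁₃)
open Literature.MathematicalPhysics.QuantumFieldTheory.Balaban1983to89.B12Sec2to5 (l1 Decay510)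

/-- An eventual bound `|a K| ≤ c` on a convergent real sequence passes to its limit. -/
theorem abs_le_of_tendsto_of_eventually_le {a : ℕ → ℝ} {A c : ℝ} (ha : Tendsto a atTop (𝓝 A)) (h : ∀ᶠ K in atTop, |a K| ≤ c) : |A| ≤ c :=
  le_of_tendsto ha.abs h

section Generic

variable {𝔄 : Type*} [NormedRing 𝔄] [NormedAlgebra ℝ 𝔄]
variable {V : Type*} [NormedAddCommGroup V] [NormedSpace ℝ V] {ι : Type*} [Fintype ι]
variable (F : T4Family) (ℰ : TermFamily1 F 𝔄) (ρ : V →L[ℝ] 𝔄) (bV : Module.Basis ι ℝ V)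

/-- ★ **(5.10) FOR ONE LIMITING KERNEL FROM THE WINDOWED (5.10) BOUNDS**: an eventual-in-`K` bound `|Π^{(K)}_{k+1,μν}(g; z)| ≤ C₀ e^{−κ|z|₁}` on the windowed finite-volume
kernels at every separation `z`, plus the existence of the (1.21) limit, give `Decay510 (kernelA F ℰ ρ bV g k μ ν) C₀ κ`. -/
theorem decay510_kernelA_of_windowed {g : ℕ → ℝ} {k : ℕ} {μ ν : Fin 4} {C₀ κ : ℝ}
    (hg : PolLimitExists F (k + 1) (fun K => ℰ k (histPrefix g k) K) ρ bV)
    (hK : ∀ z : Fin 4 → ℤ, ∀ᶠ K in atTop, |polWindow F K (k + 1) (ℰ k (histPrefix g k) K) ρ bV μ ν z| ≤ C₀ * Real.exp (-κ * l1 z)) :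
    Decay510 (kernelA F ℰ ρ bV g k μ ν) C₀ κ := by
  intro z
  rw [kernelA_eq]
  exact abs_le_of_tendsto_of_eventually_le (tendsto_polLimit F (k + 1) _ ρ bV hg μ ν z) (hK z)

/-- ★ **W1-19's `KernelDecay` FROM THE WINDOWED (5.10) BOUNDS, UNIFORM IN THE LEVEL, AND THE EXISTENCE OF THE LIMITS** on a window `W`: one constant `C₀(g)` per coupling
sequence bounding every windowed kernel of every level eventually in `K`. -/
theorem kernelDecay_of_windowed {W : Set (ℕ → ℝ)} {μ ν : Fin 4} {κ : ℝ}
    (hlim : ∀ g ∈ W, ∀ k : ℕ, PolLimitExists F (k + 1) (fun K => ℰ k (histPrefix g k) K) ρ bV)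
    (hK : ∀ g ∈ W, ∃ C₀ : ℝ, ∀ (k : ℕ) (z : Fin 4 → ℤ), ∀ᶠ K in atTop,
      |polWindow F K (k + 1) (ℰ k (histPrefix g k) K) ρ bV μ ν z| ≤ C₀ * Real.exp (-κ * l1 z)) :
    KernelDecay F ℰ ρ bV W μ ν κ := by
  intro g hg
  obtain ⟨C₀, hC⟩ := hK g hg
  exact ⟨C₀, fun k => decay510_kernelA_of_windowed F ℰ ρ bV (hlim g hg k) (hC k)⟩

end Generic

section Record

open scoped Matrix.Norms.L2Operator

variable (F : T4Family) (N : ℕ) [NeZero N]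

/-- ★★ **`KernelDecayOfRecord₁₃ F N θ μ ν κ` — dag-n27-w1's `hdec` — FROM THE WINDOWED (5.10) BOUNDS OF RECORD AND THE EXISTENCE OF THE (1.21) LIMITS OF RECORD**
(LOCATED: both inputs displayed at the merged term family of record in the record's β-chart; nothing of the record is claimed to meet them). -/
theorem kernelDecayOfRecord₁₃_of_windowed (θ : Stage13Params F N) (μ ν : Fin 4) (κ : ℝ)
    (hlim : letI := θ.instVβ₁; letI := θ.instVβ₂; letI := θ.instιβ
      ∀ g ∈ Window θ.γ, ∀ k : ℕ,
        PolLimitExists F (k + 1) (fun K => mergedTermFamilyMatT F N (TβOfRecord₁₃ F N) (chiβOfRecord₁₃ F N θ) θ.εbg k (histPrefix g k) K) θ.ρ8 θ.bV)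
    (hK : letI := θ.instVβ₁; letI := θ.instVβ₂; letI := θ.instιβ
      ∀ g ∈ Window θ.γ, ∃ C₀ : ℝ, ∀ (k : ℕ) (z : Fin 4 → ℤ), ∀ᶠ K in atTop,
        |polWindow F K (k + 1) (mergedTermFamilyMatT F N (TβOfRecord₁₃ F N) (chiβOfRecord₁₃ F N θ) θ.εbg k (histPrefix g k) K) θ.ρ8 θ.bV μ ν z| ≤
          C₀ * Real.exp (-κ * l1 z)) :
    KernelDecayOfRecord₁₃ F N θ μ ν κ := by
  letI := θ.instVβ₁; letI := θ.instVβ₂; letI := θ.instιβ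
  exact kernelDecay_of_windowed F _ θ.ρ8 θ.bV hlim hK

end Record

end YMDAG.N22.AtKernels

end
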